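import Mathlib.MeasureTheory.Measure.Hausdorff
import Literature.Analysis.FluidPDE.ClassicalSolution
import Literature.Analysis.FluidPDE.WeakSolution
import Literature.Analysis.FluidPDE.LerayHopf
import Literature.Analysis.FluidPDE.SuitableWeak
import Literature.Analysis.FluidPDE.NSWave0
import HarnessLib
import HarnessLib.Audit

-- provenance: harness21/H21/H21/Statements/NS/LerayHopf.lean @ 5b06834 (interim HEAD d8f2665); M5 mechanical rewrite
/-!
# Navier–Stokes (family `ns`): Leray–Hopf weak solutions — existence, conditional regularity,
  (non-)uniqueness, blow-up necessary conditions

Trunk: FluidKinetic (outline `H21/Outlines/FluidKinetic.md`, item `NSLerayHopf`). Statement file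
built on the accepted Prelude notions `Fluid.IsLerayHopfOn` / `Fluid.IsGlobalLerayHopf`
(`Prelude/FluidKinetic/LerayHopf`), their torus twins `Torus.IsLerayHopfOn` /
`Torus.IsGlobalLerayHopf`, the mixed norms `Fluid.MemLqLp`, classical solutions
`Fluid.IsClassicalNSSolutionOn` / `Fluid.IsMaximalSmoothSolution` (`ClassicalSolution`), and the
regular/singular points `Fluid.IsRegularPoint` / `Fluid.IsSingularTime` (`SuitableWeak`).

## Contents

* `NS.isNavierStokesSolution_and_smooth_iff` — the bridge between the wave-0 Clay predicate
  `NS.IsNavierStokesSolution ∧ IsSmoothOnHalfSpace u ∧ IsSmoothOnHalfSpace p` and the Prelude's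
  `Fluid.IsClassicalNSSolutionOn (Ici 0)` (real proof: the two are field-for-field the same).
* **ns.S05** `NS.isLerayHopfOn_iff`, `NS.torus_isLerayHopfOn_iff` — the definition of Leray–Hopf
  weak solutions on `ℝ³` / `𝕋³`, unfolded into its clauses (Leray 1934; Hopf 1951).
* **ns.S06** `NS.leray_existence_R3`, `NS.hopf_existence_torus` — global existence
  (Leray 1934, Ch. V, §31, Théorème d'existence, p. 241; Hopf 1951). *Proof status (2026-08,
  statements unchanged):* `hopf_existence_torus` is discharged in `NSHopfExistenceProofs.lean`
  (`hopf_existence_torus_holds`, Fourier–Galerkin); `leray_existence_R3` is decomposed along Leray's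
  own proof (Ch. V, §§26–31) in `NSLerayRegularised.lean` (`leray_existence_R3_of_regularised`), its
  limit half is proved (`leray_regularised_limit_holds`, `NSLerayRegularisedLimitHolds.lean`), and
  `leray_existence_R3_of_scheme_exists` / `leray_existence_R3_of_wellposed_of_limit` reduce it to the
  single named fact `leray_regularised_wellposed` (`NSLerayRegularisedExistence.lean`).
* **ns.S06′** `NS.hopf_existence_torus.steady` (steady smooth forcing, proved from ns.S06),
  `NS.hopf_existence_torus_invariant` — Hopf's theorem within the closed `x₃`-invariant ("2½-D")
  class (named fact, folklore strengthening of Hopf 1951: the Galerkin scheme run in the invariant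
  subspace; 2½-D structure as in Bruè–De Lellis 2023, §3.1), with the proved specialisation
  `NS.hopf_existence_torus_invariant.symmetric_lh_existence` (crux of route
  `AnomalousDissipation/TwoAndHalfD`).
* **ns.S07** `NS.ladyzhenskaya_prodi_serrin`, `NS.weak_strong_uniqueness` — LPS conditional
  regularity and weak–strong uniqueness (Prodi 1959; Serrin 1962/63; Ladyzhenskaya 1967).
* **ns.S08** `NS.ess_endpoint`, `NS.seregin_L3_blowup` — the endpoint `L^∞_t L³_x`
  (Escauriaza–Seregin–Šverák 2003, Thms. 1.3–1.4; Seregin 2012, Thm. 1.1).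
* **ns.S19** `NS.LerayHopfNonUniqueness`, `NS.EnergyClassNonUniqueness` — open problems
  (Jia–Šverák 2015; Buckmaster–Vicol 2019, §8, Problem 9), as `def … : Prop`. *Status note (2026-08):* open
  in these sources; the implication `LerayHopfNonUniqueness → EnergyClassNonUniqueness` is proved in
  `NSLerayHopfNonUniqueness.lean`; a computer-assisted proof of Leray–Hopf non-uniqueness for the unforced
  problem on `ℝ³` has since been announced (Hou–Wang–Yang 2025, arXiv:2509.25116, Thm. 1 — unrefereed claim),
  whose content is rendered by the claim-tagged predicate `HouWangYang2025.IsNonuniqueFamily` (no named fact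
  is minted for an unrefereed claim), with its reduction to `LerayHopfNonUniqueness`, in
  `HouWangYang2025Nonuniqueness.lean`; the statements here are unchanged.
* **ns.S20** `NS.albritton_brue_colombo` — forced non-uniqueness (ABC 2022, Thm. 1.1).
* `NS.galdi_energy_equality` — very weak solutions in `L⁴_t L⁴_x` are in the Leray–Hopf class and
  satisfy the energy equality, no finite energy/dissipation assumed (Galdi 2018, Thm. 1.1).
* **ns.S28** `NS.leray_blowup_rate`, `NS.leray_blowup_rate_top`, `NS.scheffer_singular_times` —
  Leray's necessary conditions at a blow-up time and the `ℋ^{1/2}`-null set of singular times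
  (Leray 1934, §19 (3.9) p. 224, §22 p. 227, §34; Scheffer 1977). *Decomposition note
  (2026-08, statements unchanged):* both rates are assembled downstream, with proved glue, from
  Leray's local theory — `leray_blowup_rate_top_of_strong_local_existence`
  (`NSLerayBlowupRate.lean`, from the named fact `leray_strong_local_existence`: Leray §19 (3.8) /
  Ożański–Pooley 2018, Thm. 6.22) and `leray_blowup_rate_of_top_of_supnorm`
  (`NSLerayBlowupRateLp.lean`, from `leray_blowup_rate_top` and the named fact
  `leray_supnorm_le_of_Lp`: Leray §21 (3.5), (3.14)–(3.16) / Ożański–Pooley 2018,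
  Lemma 6.23 (iii)). Neither rate nor either leaf is discharged yet: the discharges
  `leray_blowup_rate_top_holds`, `leray_blowup_rate_holds` will be the one-line compositions of
  that glue with the discharges of the two leaves, in a file downstream of the assembly files
  (this statement file cannot import them) — no further decomposition of either rate is called for.

## Mathlib search

Mathlib (this pin) has no Navier–Stokes, Leray–Hopf, Serrin-class or blow-up notions (searched
`Leray`, `NavierStokes`, `Serrin`, `LqLp`: none). Used from Mathlib: `MeasureTheory.eLpNorm`,
`MemLp`, `Measure.hausdorffMeasure` (`μH[d]`), `Filter.Tendsto`, `𝓝[<] T`, `ae` (`=ᵐ[volume]`),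
`Real.rpow`, `Real.sqrt`.

## Design choices

* Physical space is `ℝ³ := EuclideanSpace ℝ (Fin 3)`, the torus is `𝕋³ := UnitAddTorus (Fin 3)`
  (local notations). The bridge and the **ns.S05** characterisations are stated for a general
  finite-dimensional inner product space `E` / index type `d`, as the Prelude notions are.
* All viscosities are hypotheses `0 < ν` (or `∃ ν > 0` / `∀ ν > 0` inside `Prop`s).
* Declaration names (`leray_existence_R3`, `seregin_L3_blowup`, `LerayHopfNonUniqueness`,
  `EnergyClassNonUniqueness`, …) are the ones fixed by the architect's outline for this item
  (`planned_decls`), kept verbatim so that cross-file references resolve.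
* A Leray–Hopf solution is an honest function `u : ℝ → E → E` seen only through integrals, so
  "`u` is smooth" is rendered as "*`u(t)` agrees a.e. with `v(t)` for every `t`, for some classical
  solution `(v, p)`*", and "`u = v`" (uniqueness) as `∀ t ∈ Ioc 0 T, u t =ᵐ[volume] v t`.
  **The slice `u 0` is never compared**: `Fluid.IsLerayHopfOn T ν f u₀ u` sees `u` only on
  `(0, T]` (the datum enters through `u₀`; the only constraints at `t = 0` are `u 0 ∈ L²` and
  `‖u 0‖₂ ≤ ‖u₀‖₂`), so distinctness / uniqueness clauses quantify over `t > 0` (or are a.e. in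
  space–time on `Ioi 0 ×ˢ univ`), where weak `L²` continuity pins every slice. Distinctness is
  written positively, `∃ t, 0 < t ∧ ¬ (u t =ᵐ[volume] v t)`.
* Letters: `p` is always the pressure (as in the rest of the trunk); the Lebesgue exponents of
  the Serrin class are `(q, r)` (time, space) and Leray's rate exponent is `r`.
* LPS regularity and weak–strong uniqueness (**ns.S07**) are asserted up to and including the
  final time, on `(0, T] × ℝ³` (`Fluid.IsClassicalNSSolutionOn (Ioc 0 T)`, slices compared on
  `Ioc 0 T`), as in Robinson–Rodrigo–Sadowski 2016, Thm. 8.17 ("smooth on `(0, T]`"); this is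
  meaningful because the accepted `Fluid.IsLerayHopfOn T` sees the slice `u T` (its clauses live
  on `Icc 0 T` / `Ioc 0 T`). The ESS endpoint regularity (**ns.S08**) is asserted on the **open**
  strip `Q_T = (0, T) × ℝ³`, exactly as ESS 2003, Thm. 1.4, while its uniqueness clause is on
  `Ioc 0 T` for uniformity with **ns.S07**. Both are stated for the unforced Cauchy problem
  (`f = 0`), the setting of the cited theorems.
* Leray's blow-up rates (**ns.S28**) and Seregin's `L³` criterion (**ns.S08**) concern a solution
  that is *regular in Leray's sense* on `[0, T)` and cannot be continued: we take `(u, p)` a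
  maximal smooth solution (`Fluid.IsMaximalSmoothSolution ν 0 u p T`) which is moreover a
  Leray–Hopf (finite-energy) solution on `[0, T)` and essentially bounded on every closed
  sub-strip `[0, T'] × ℝ³`, `0 < T' < T` (Leray 1934, §19: "solution régulière"). Under these
  hypotheses `u` is the unique strong solution from each of its time slices, so the printed proofs
  apply verbatim. Note that `Fluid.IsLerayHopfOn T ν 0 (u 0) u` also constrains the single slice
  `u T` (square-integrable, weak-`L²` limit of `u(t)`, `t → T⁻`, energy inequality at `t = T`);
  this normalises the value of the function `u` at the blow-up time only — a slice which neither
  `IsMaximalSmoothSolution` (on `Ico 0 T`) nor the boundedness hypothesis sees — and does not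
  weaken the statements in substance.
  The constant `c_p` is universal (quantified before the solution). Norms are `eLpNorm` in `ℝ≥0∞`
  (no `toReal`); the real lower bound enters through `ENNReal.ofReal`.
* Scheffer's theorem is stated for the accepted `Fluid.IsSingularTime` (some point `(T, x)` is not
  a regular point, i.e. `u` is not essentially bounded on any parabolic cylinder around it) and
  Mathlib's Hausdorff measure `μH[1/2]` on `ℝ`.
* The energy-class variant of the non-uniqueness problem (**ns.S19**, `W_E`) uses the auxiliary
  predicate `NS.MemEnergyClass` (`u ∈ L^∞(0,T; L²) ∩ L²(0,T; Ḣ¹)` via a weak gradient — the first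
  two Leray–Hopf clauses without the energy inequality; stated over a general `E` like
  `Fluid.IsLerayHopfOn`, with the projection `NS.memEnergyClass_of_isLerayHopfOn` proved).

## References

* J. Leray, *Sur le mouvement d'un liquide visqueux emplissant l'espace*, Acta Math. 63 (1934),
  193–248: Ch. III, §15, p. 217 (solution régulière), §19, (3.8)–(3.9), pp. 222–224 (local
  existence with the lifespan (3.8); "premier caractère des irrégularités" (3.9), p. 224), §21,
  (3.13)–(3.19), pp. 225–227, §22, p. 227 ("caractère des irrégularités" in `Lᵖ`, `p > 3`, stated
  "on établit de même"); Ch. V, §31, pp. 240–241 (solutions turbulentes; Théorème d'existence,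
  p. 241); Ch. VI, §34 (théorème de structure). English translation by R. Terrell,
  arXiv:1604.02484.
* W. S. Ożański, B. C. Pooley, *Leray's fundamental work on the Navier–Stokes equations: a modern
  review of "Sur le mouvement d'un liquide visqueux emplissant l'espace"*, in: Partial
  Differential Equations in Fluid Mechanics, LMS Lecture Note Ser. 452 (CUP 2018), §6.1 (`ν = 1`
  by rescaling), Def. 6.35, Cor. 6.36, Thm. 6.37 (modern statement of Leray's existence theorem,
  "Sections 28–31 of Leray (1934b)"); §6.3.2, Thm. 6.22 (local existence from `u₀ ∈ H ∩ L^∞`,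
  `T > C/‖u₀‖²_∞`), §6.3.3, Lemma 6.23, Cor. 6.24, Cor. 6.25 (the blow-up rates, with proofs;
  "Sections 21 and 22 in Leray (1934b)").
* Y. Giga, *Solutions for semilinear parabolic equations in `Lᵖ` and regularity of weak solutions
  of the Navier–Stokes system*, J. Differential Equations 62 (1986), 186–212, Thm. 4, (4.8)
  (p. 202: the `Lʳ` rates, `r > n`, for mild solutions in `C([0, T⁎); Lʳ)`, with proof; "In the
  case `Ω = ℝ³`, (4.8) was given by Leray").
* E. Hopf, *Über die Anfangswertaufgabe für die hydrodynamischen Grundgleichungen*, Math. Nachr. 4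
  (1951), 213–231.
* P. Constantin, C. Foias, *Navier–Stokes Equations* (Chicago 1988), Ch. 8, Theorem (Leray)
  (Galerkin existence, `u₀ ∈ H`, `f ∈ L²(0,T;V')`).
* A. J. Majda, A. L. Bertozzi, *Vorticity and Incompressible Flow* (CUP 2002), §2.3.1,
  Prop. 2.7 (2½-D flows: `x₃`-independent 3-D flows = 2-D Navier–Stokes + advected–diffused `u₃`).
* E. Bruè, C. De Lellis, *Anomalous dissipation for the forced 3D Navier–Stokes equations*,
  Comm. Math. Phys. 400 (2023), §3.1 (the `(2+½)`-dimensional flow).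
* G. Prodi, *Un teorema di unicità per le equazioni di Navier–Stokes*, Ann. Mat. Pura Appl. 48
  (1959); J. Serrin, ARMA 9 (1962) and *The initial value problem for the Navier–Stokes
  equations* (1963); O. A. Ladyzhenskaya (1967).
* L. Escauriaza, G. Seregin, V. Šverák, *`L_{3,∞}`-solutions of Navier–Stokes equations and
  backward uniqueness*, Russ. Math. Surveys 58 (2003), Thms. 1.3–1.4.
* G. Seregin, *A certain necessary condition of potential blow up for Navier–Stokes equations*,
  Comm. Math. Phys. 312 (2012), Thm. 1.1.
* H. Jia, V. Šverák, J. Funct. Anal. 268 (2015); T. Buckmaster, V. Vicol, EMS Surv. Math. Sci. 6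
  (2019), §8, Problem 9.
* T. Y. Hou, Y. Wang, C. Yang, *Nonuniqueness of Leray–Hopf solutions to the unforced incompressible 3D
  Navier–Stokes Equation*, arXiv:2509.25116 (2025), Thm. 1 (computer-assisted; unrefereed claim — see
  `HouWangYang2025Nonuniqueness.lean`).
* D. Albritton, E. Brué, M. Colombo, *Non-uniqueness of Leray solutions of the forced
  Navier–Stokes equations*, Ann. of Math. 196 (2022), Thm. 1.1.
* V. Scheffer, *Turbulence and Hausdorff dimension*, Comm. Math. Phys. 55 (1977).
* J. C. Robinson, J. L. Rodrigo, W. Sadowski, *The three-dimensional Navier–Stokes equations*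
  (CUP 2016), Thms. 6.10, 8.17, 8.19 (modern statements of weak–strong uniqueness and LPS),
  Lemma 6.11 (the `H¹` rate), Notes to Ch. 11, (11.18) with Exercises 11.6–11.8 (the `Lᵖ` rates:
  "Such lower bounds were stated by Leray without proof");
  Def. 4.9 and Thm. 14.4 (Leray–Hopf weak solutions on `ℝ³` with the strong energy inequality, by
  the Leray regularisation); §4.4, Thm. 4.10 (expanding domains: weak solutions "not known to
  satisfy the strong energy inequality").
-/

noncomputable section

open MeasureTheory TopologicalSpace Set Function Filter Topology
open scoped InnerProductSpace RealInnerProductSpace ENNReal NNReal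

namespace Literature.Analysis.FluidPDE

/-! ### Bridge: the wave-0 Clay predicate versus `Fluid.IsClassicalNSSolutionOn (Ici 0)` -/

section Bridge

variable {E : Type*} [NormedAddCommGroup E] [InnerProductSpace ℝ E] [FiniteDimensional ℝ E]
variable {ν : ℝ} {f u : ℝ → E → E} {u₀ : E → E} {p : ℝ → E → ℝ}

/-- **Bridge lemma.** The wave-0 rendering of Fefferman's (1), (2), (3), (6) —
`NS.IsNavierStokesSolution ν f u₀ u p` together with joint smoothness of `u` and `p` on
`[0, ∞) × E` — is the same thing as a classical solution on the time set `Ici 0` in the sense of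
the Prelude (`Fluid.IsClassicalNSSolutionOn`, whose fields carry the smoothness) with `u 0 = u₀`.
Real proof: `Fluid.IsSmoothSpaceTimeOn (Ici 0)` is verbatim `NS.IsSmoothOnHalfSpace`,
`Fluid.timeDerivWithin`, `Fluid.convect`, `Fluid.IsDivFree` unfold to the wave-0 expressions
(Fefferman 2000/2006, (1)–(3), (6)). [cite: Fefferman2000, /2006  (1] -/
theorem isNavierStokesSolution_and_smooth_iff :
    IsNavierStokesSolution ν f u₀ u p ∧ IsSmoothOnHalfSpace u ∧ IsSmoothOnHalfSpace p ↔
      FluidPDE.IsClassicalNSSolutionOn (Ici 0) ν f u p ∧ u 0 = u₀ := by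
  constructor
  · rintro ⟨hns, hu, hp⟩
    exact ⟨⟨hu, hp, fun t ht x => hns.momentum t ht x, fun t ht => hns.divFree t ht⟩, hns.initial⟩
  · rintro ⟨hcl, h0⟩
    exact ⟨⟨fun t ht x => hcl.momentum t ht x, fun t ht => hcl.divFree t ht, h0⟩,
      hcl.smooth_velocity, hcl.smooth_pressure⟩

end Bridge

/-! ### ns.S05: the Leray–Hopf clauses -/

section Characterisation

variable {E : Type*} [NormedAddCommGroup E] [InnerProductSpace ℝ E] [FiniteDimensional ℝ E]
  [MeasurableSpace E] [BorelSpace E]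
variable {T ν : ℝ} {f u : ℝ → E → E} {u₀ : E → E}

/-- **ns.S05** (Leray–Hopf weak solutions on `ℝ³ × [0, T)`; Leray 1934, Acta Math. 63, §III,
§§31–33; Hopf 1951, Math. Nachr. 4). `u` is a Leray–Hopf weak solution of the forced
Navier–Stokes system with viscosity `ν`, force `f` and datum `u₀` on `[0, T)` iff
(i) `u` is a distributional (pressure-free, divergence-free-tested) solution with datum `u₀`;
(ii) `u ∈ L^∞(0, T; L²)`, and every slice `u(t)`, `t ∈ [0, T]`, lies in `L²`;
(iii) `∇u ∈ L²(0, T; L²)` through a weak gradient `G`, with the **energy inequality**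
`½‖u(t)‖₂² + ν ∫ₛᵗ ‖G‖₂² ≤ ½‖u(s)‖₂² + ∫ₛᵗ∫⟪f, u⟫` from `s = 0` (with `u₀`) for every
`t ∈ [0, T]` and from a.e. `s ∈ (0, T)` for every `t ∈ [s, T]`;
(iv) `u` is weakly continuous into `L²` on `(0, T]` with weak limit `u₀` at `0⁺`;
(v) `u(t) → u₀` strongly in `L²` as `t → 0⁺`.
This unfolds the accepted `Fluid.IsLerayHopfOn` field by field. [cite: Leray1934, Acta Math. 63  §III  §§31–33] -/
theorem isLerayHopfOn_iff :
    FluidPDE.IsLerayHopfOn T ν f u₀ u ↔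
      FluidPDE.IsWeakNSSolutionOn T ν f u₀ u ∧
      (∃ C : ℝ≥0, ∀ᵐ t ∂(volume.restrict (Ioo 0 T)), FluidPDE.eEnergy (u t) ≤ C) ∧
      (∀ t ∈ Icc 0 T, MemLp (u t) 2 volume) ∧
      (∃ G : ℝ → E → E →L[ℝ] E,
        (∀ᵐ t ∂(volume.restrict (Ioo 0 T)), FluidPDE.HasWeakGradient (u t) (G t)) ∧
        (∫⁻ t in Ioo 0 T, ∫⁻ x, ENNReal.ofReal (FluidPDE.frobeniusNormSq (G t x)) < ∞) ∧
        (∀ t ∈ Icc 0 T, VectorCalculus.kineticEnergy (u t) +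
            ν * (∫⁻ τ in Ioo 0 t, ∫⁻ x, ENNReal.ofReal (FluidPDE.frobeniusNormSq (G τ x))).toReal ≤
          VectorCalculus.kineticEnergy u₀ + ∫ τ in 0..t, ∫ x, ⟪f τ x, u τ x⟫) ∧
        (∀ᵐ s ∂(volume.restrict (Ioo 0 T)), ∀ t ∈ Icc s T, VectorCalculus.kineticEnergy (u t) +
            ν * (∫⁻ τ in Ioo s t, ∫⁻ x, ENNReal.ofReal (FluidPDE.frobeniusNormSq (G τ x))).toReal ≤
          VectorCalculus.kineticEnergy (u s) + ∫ τ in s..t, ∫ x, ⟪f τ x, u τ x⟫)) ∧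
      (∀ w : E → E, MemLp w 2 volume →
        ContinuousOn (fun t => ∫ x, ⟪u t x, w x⟫) (Ioc 0 T) ∧
          Tendsto (fun t => ∫ x, ⟪u t x, w x⟫) (𝓝[>] 0) (𝓝 (∫ x, ⟪u₀ x, w x⟫))) ∧
      Tendsto (fun t => eLpNorm (u t - u₀) 2 volume) (𝓝[>] 0) (𝓝 0) :=
  ⟨fun h => ⟨h.weak, h.energy_bound, h.memLp, h.weakGrad_energy, h.weak_continuous,
      h.strong_initial⟩,
    fun ⟨h₁, h₂, h₃, h₄, h₅, h₆⟩ => ⟨h₁, h₂, h₃, h₄, h₅, h₆⟩⟩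

end Characterisation

section CharacterisationTorus

variable {d : Type*} [Fintype d] [DecidableEq d]
variable {T ν : ℝ} {f u : ℝ → UnitAddTorus d → EuclideanSpace ℝ d}
  {u₀ : UnitAddTorus d → EuclideanSpace ℝ d}

/-- **ns.S05** (Leray–Hopf weak solutions on `𝕋³ × [0, T)`, torus twin; Leray 1934, Acta Math.
63, §III; Hopf 1951, Math. Nachr. 4; Temam, Ch. III, Thm. 3.1). `u` is a Leray–Hopf weak
solution on the flat torus iff (i) it is a forced weak solution with datum `u₀`;
(ii) `u ∈ L^∞(0, T; L²)`, and every slice `u(t)`, `t ∈ [0, T]`, lies in `L²`;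
(iii) `u ∈ L²(0, T; H¹)` (spectrally, `Torus.MemL2Sobolev 0 T 1`);
(iv) the energy inequality holds from `s = 0` for every `t ∈ [0, T]` and (v) from a.e.
`s ∈ (0, T)` for every `t ∈ [s, T]`, dissipation measured by `Torus.eGradNormSq`;
(vi) weak `L²` continuity on `(0, T]` with weak limit `u₀` at `0⁺`; (vii) strong attainment of
the datum in `L²`. Unfolds the accepted `Torus.IsLerayHopfOn`. [cite: Leray1934, Acta Math. 63  §III] -/
theorem torus_isLerayHopfOn_iff :
    Torus.IsLerayHopfOn T ν f u₀ u ↔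
      Torus.IsWeakNSSolutionForcedOn T ν f u₀ u ∧
      (∃ C : ℝ≥0, ∀ᵐ t ∂(volume.restrict (Ioo 0 T)), ∫⁻ x, ‖u t x‖ₑ ^ 2 ≤ C) ∧
      (∀ t ∈ Icc 0 T, MemLp (u t) 2 volume) ∧
      FunctionSpaces.Torus.MemL2Sobolev 0 T 1 (fun t => FunctionSpaces.EuclideanSpace.complexify ∘ u t) ∧
      (∀ t ∈ Icc 0 T,
        FunctionSpaces.Torus.kineticEnergy (u t) + ν * (∫⁻ τ in Ioo 0 t, FunctionSpaces.Torus.eGradNormSq (u τ)).toReal ≤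
          FunctionSpaces.Torus.kineticEnergy u₀ + ∫ τ in 0..t, ∫ x, ⟪f τ x, u τ x⟫) ∧
      (∀ᵐ s ∂(volume.restrict (Ioo 0 T)), ∀ t ∈ Icc s T,
        FunctionSpaces.Torus.kineticEnergy (u t) + ν * (∫⁻ τ in Ioo s t, FunctionSpaces.Torus.eGradNormSq (u τ)).toReal ≤
          FunctionSpaces.Torus.kineticEnergy (u s) + ∫ τ in s..t, ∫ x, ⟪f τ x, u τ x⟫) ∧
      (∀ w : UnitAddTorus d → EuclideanSpace ℝ d, MemLp w 2 volume →
        ContinuousOn (fun t => ∫ x, ⟪u t x, w x⟫) (Ioc 0 T) ∧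
          Tendsto (fun t => ∫ x, ⟪u t x, w x⟫) (𝓝[>] 0) (𝓝 (∫ x, ⟪u₀ x, w x⟫))) ∧
      Tendsto (fun t => eLpNorm (u t - u₀) 2 volume) (𝓝[>] 0) (𝓝 0) :=
  ⟨fun h => ⟨h.weak, h.energy_bound, h.memLp, h.memL2Sobolev, h.energy_ineq_zero,
      h.energy_ineq_ae, h.weak_continuous, h.strong_initial⟩,
    fun ⟨h₁, h₂, h₃, h₄, h₅, h₆, h₇, h₈⟩ => ⟨h₁, h₂, h₃, h₄, h₅, h₆, h₇, h₈⟩⟩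

end CharacterisationTorus

/-! ### The statements on `ℝ³` and `𝕋³` -/

/-- Local notation for physical space `ℝ³ = EuclideanSpace ℝ (Fin 3)`. -/
local notation "ℝ³" => EuclideanSpace ℝ (Fin 3)

/-- Local notation for the flat unit torus `𝕋³ = UnitAddTorus (Fin 3)`. -/
local notation "𝕋³" => UnitAddTorus (Fin 3)

/-! #### ns.S06: global existence (Leray on `ℝ³`, Hopf on `𝕋³`) -/

/-- **ns.S06** (Leray's existence theorem on `ℝ³`; Leray 1934, Acta Math. 63, Ch. V, §31, p. 241,
*Théorème d'existence*: "Supposons donné à l'instant initial un état initial `Uᵢ(x)`, tel que les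
fonctions `Uᵢ(x)` soient de carrés sommables sur `Π` et que le vecteur de composantes `Uᵢ(x)`
possède une quasi-divergence nulle. Il correspond à cet état initial au moins une solution
turbulente, qui est définie pour toutes les valeurs du temps postérieures à l'instant initial."
The *solutions turbulentes* are defined in the same §31 (pp. 240–241) by the clauses that the
accepted `Fluid.IsLerayHopfOn` renders: square-integrable slices of quasi-divergence zero, the
integral relation (5.15) (weak form), square-integrable quasi-derivatives and the energy
inequality from every non-singular time — the singular times forming a null set not containing
`t = 0` — and weak convergence in mean of the slices. Modern statements: Ożański–Pooley 2018,
Thm. 6.37 with Def. 6.35 and Cor. 6.36 (`u₀ ∈ H` ⇒ a weak solution with the energy inequality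
(6.87) from every `s ∉ S`, `|S| = 0`, `0 ∉ S`, `L²`-weakly continuous, `‖u(t) − u₀‖ → 0`;
"Sections 28–31 of Leray (1934b)"); Robinson–Rodrigo–Sadowski 2016, Thm. 14.4 (strong energy
inequality for `s = 0` and a.e. `s > 0`, all `t ≥ s`). RRS 2016, Thm. 4.10 (expanding domains,
after Heywood) is *not* a source for this statement: its solutions are "not known to satisfy the
strong energy inequality" (loc. cit., §4.4), which `Fluid.IsLerayHopfOn` demands. Leray keeps the
viscosity `ν > 0` explicit; OP and RRS normalise `ν = 1` and recover `ν > 0` by rescaling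
(OP 2018, §6.1).)
For every viscosity `ν > 0` and every divergence-free (in the weak sense) datum `u₀ ∈ L²(ℝ³)`
there is a global Leray–Hopf weak solution of the unforced Navier–Stokes system with datum
`u₀`.
*Proof status (2026-08, statement unchanged).* Decomposed along Leray's own proof (Ch. V,
§§26–31: Leray regularisation, répartition de l'énergie, passage to the limit) in
`NSLerayRegularised.lean`: `leray_existence_R3_of_regularised :
leray_regularised_scheme_exists → leray_regularised_limit → leray_existence_R3`. The limit half
is **proved** (`leray_regularised_limit_holds`, `NSLerayRegularisedLimit*.lean`), whence
`leray_existence_R3_of_scheme_exists : leray_regularised_scheme_exists → leray_existence_R3`;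
the scheme half is reduced (`leray_regularised_scheme_exists_of_wellposed`,
`NSLerayRegularisedExistence.lean`) to the single named fact `leray_regularised_wellposed`
(global well-posedness of the regularised problem with the `ε`-uniform tail estimate; Leray
§§26–27, OP Thm. 6.33 and Lemma 6.34), so that the discharge of the present fact is the
composition `leray_existence_R3_of_scheme_exists (leray_regularised_scheme_exists_of_wellposed
‹leray_regularised_wellposed›)` in a sibling proof file (this statement file cannot import the
proof files) once `leray_regularised_wellposed` is discharged — no further decomposition of this
fact is called for. [cite: Leray1934, Ch. V §31, p. 241, Théorème d'existence] [cite: OzanskiPooley2018, Thm. 6.37, Def. 6.35, Cor. 6.36] [cite: RobinsonRodrigoSadowski2016, Thm. 14.4] -/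
def leray_existence_R3 : Prop :=
  ∀ (ν : ℝ) (hν : 0 < ν) (u₀ : ℝ³ → ℝ³) (hu₀ : MemLp u₀ 2 volume) (hdiv : FluidPDE.IsWeaklyDivFree u₀),
    ∃ u : ℝ → ℝ³ → ℝ³, FluidPDE.IsGlobalLerayHopf ν 0 u₀ u

/-- **ns.S06** (Hopf's existence theorem on `𝕋³`, forced; Hopf 1951, Math. Nachr. 4; Temam,
*Navier–Stokes equations*, Ch. III, Thm. 3.1; Robinson–Rodrigo–Sadowski 2016, Thm. 4.4).
For every `ν > 0`, every weakly divergence-free datum `u₀ ∈ L²(𝕋³)` and every space–time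
measurable force `f ∈ L²((0, T) × 𝕋³)` for all `T > 0`, there is a global Leray–Hopf weak
solution on the flat torus with datum `u₀` and force `f`. Measurability of `f` is phrased through
the space–time lift `Torus.stLift` to `ℝ × ℝ³`, as in the accepted `Torus.IsWeakNSSolutionForcedOn`.
[cite: Hopf1951, Math. Nachr. 4] -/
def hopf_existence_torus : Prop :=
  ∀ (ν : ℝ) (hν : 0 < ν) (u₀ : 𝕋³ → ℝ³) (hu₀ : MemLp u₀ 2 volume) (hdiv : FunctionSpaces.Torus.IsWeaklyDivFree u₀) (f : ℝ → 𝕋³ → ℝ³) (hf : AEStronglyMeasurable (FunctionSpaces.Torus.stLift f) (volume.restrict (Ioi 0 ×ˢ univ))) (hf₂ : ∀ T, 0 < T → ∫⁻ t in Ioo 0 T, ∫⁻ x, ‖f t x‖ₑ ^ 2 < ∞),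
    ∃ u : ℝ → 𝕋³ → ℝ³, Torus.IsGlobalLerayHopf ν f u₀ u

/-! #### ns.S06′: steady smooth forces; Hopf's theorem in the closed `x₃`-invariant (2½-D) class -/

section SteadyInvariant

/-- The space–time lift of a **steady** field `(t, x) ↦ f x` on the torus is continuous as soon
as `f` is smooth (it is `Torus.lift f ∘ Prod.snd`), hence a.e. strongly measurable for every
measure on `ℝ × ℝ^d` — the measurability hypothesis of `hopf_existence_torus` for steady smooth
forcing. Stated over a general finite index type `d`. [folklore] -/
theorem aestronglyMeasurable_stLift_const {d : Type*} [Fintype d]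
    {f : UnitAddTorus d → EuclideanSpace ℝ d} (hf : FunctionSpaces.Torus.IsSmooth f)
    (μ : Measure (ℝ × EuclideanSpace ℝ d)) :
    AEStronglyMeasurable (FunctionSpaces.Torus.stLift (fun _ : ℝ => f)) μ := by
  have hc : Continuous (FunctionSpaces.Torus.stLift (fun _ : ℝ => f)) :=
    show Continuous fun p : ℝ × EuclideanSpace ℝ d => f (FunctionSpaces.Torus.proj p.2) from
      hf.continuous.comp (FunctionSpaces.Torus.continuous_proj.comp continuous_snd)
  exact hc.aestronglyMeasurable

/-- A steady smooth force has finite space–time `L²` norm on every strip `(0, T) × T^d`: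
`∫₀ᵀ ∫ ‖f‖² = T · ‖f‖₂² < ∞` (`f` is continuous on the compact torus, `Torus.IsSmooth.memLp`) —
the integrability hypothesis of `hopf_existence_torus` for steady smooth forcing. [folklore] -/
theorem lintegral_enorm_sq_const_lt_top {d : Type*} [Fintype d]
    {f : UnitAddTorus d → EuclideanSpace ℝ d} (hf : FunctionSpaces.Torus.IsSmooth f) (T : ℝ) :
    ∫⁻ _ in Ioo 0 T, ∫⁻ x, ‖f x‖ₑ ^ 2 < ∞ := by
  rw [setLIntegral_const]
  refine ENNReal.mul_lt_top ?_ measure_Ioo_lt_top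
  have h := lintegral_rpow_enorm_lt_top_of_eLpNorm_lt_top two_ne_zero ENNReal.ofNat_ne_top
    (hf.memLp 2).eLpNorm_lt_top
  simpa only [ENNReal.toReal_ofNat, ENNReal.rpow_ofNat] using h

/-- **Steady smooth forcing** (the setting of `Turb.ZerothLaw`) is a special case of Hopf's
theorem `hopf_existence_torus`: for `ν > 0`, a weakly divergence-free datum `u₀ ∈ L²(𝕋³)` and a
smooth time-independent force `f`, there is a global Leray–Hopf solution forced by `(t ↦ f)`
(Hopf 1951; Constantin–Foias 1988, Ch. 8, Theorem (Leray), `f ∈ L²(0,T;V')`). Real proof from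
the named fact via `aestronglyMeasurable_stLift_const` and `lintegral_enorm_sq_const_lt_top`. [cite: Hopf1951, Math. Nachr. 4] -/
theorem hopf_existence_torus.steady (h : hopf_existence_torus) {ν : ℝ} (hν : 0 < ν)
    {f : 𝕋³ → ℝ³} (hf : FunctionSpaces.Torus.IsSmooth f) {u₀ : 𝕋³ → ℝ³} (hu₀ : MemLp u₀ 2 volume)
    (hdiv : FunctionSpaces.Torus.IsWeaklyDivFree u₀) :
    ∃ u : ℝ → 𝕋³ → ℝ³, Torus.IsGlobalLerayHopf ν (fun _ => f) u₀ u :=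
  h ν hν u₀ hu₀ hdiv (fun _ => f) (aestronglyMeasurable_stLift_const hf _)
    fun T _ => lintegral_enorm_sq_const_lt_top hf T

/-- **ns.S06′** (Hopf's existence theorem on `𝕋³` **within the closed `x₃`-invariant class**;
"2½-dimensional" Leray–Hopf solutions). For every `ν > 0`, every weakly divergence-free datum
`u₀ ∈ L²(𝕋³)` and every space–time measurable force `f ∈ L²((0, T) × 𝕋³)` for all `T > 0`
(hypotheses verbatim those of `hopf_existence_torus`), if `u₀` and every slice `f t` are invariant
under all translations along the third coordinate axis, `x ↦ x + s e₃` (`s : UnitAddCircle`,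
`e₃ = Pi.single 2`), then there is a global Leray–Hopf weak solution `u` with datum `u₀` and force
`f` every slice `u t` of which is invariant under the same translations.

*Provenance.* The printed existence theorems — Hopf 1951, Math. Nachr. 4, §§2–4 (Galerkin
scheme); Constantin–Foias 1988, Ch. 8, Theorem (Leray) (`u₀ ∈ H`, `f ∈ L²(0,T;V')`, periodic
case included); Temam, Ch. III, Thm. 3.1; Robinson–Rodrigo–Sadowski 2016, Thm. 4.4 (`𝕋³`) — carry
no symmetry clause, and since Leray–Hopf solutions are not known to be unique the invariance
cannot be transferred a posteriori. It is obtained by running the *same* Galerkin scheme in the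
closed subspace `H_sym ⊂ H` of `x₃`-independent fields (Fourier modes with `k₃ = 0`): the
Galerkin projectors `P_m` built from Stokes eigenfunctions, the Stokes operator and the Leray
projector commute with the translations `τ_s`, and the bilinear term maps `H_sym` to itself
(the "2½-D" structure: an `x₃`-independent field is a 2-D Navier–Stokes flow `(u₁, u₂)(x₁, x₂)`
carrying the passively advected–diffused third component `u₃(x₁, x₂)`; Majda–Bertozzi 2002,
§2.3.1, Prop. 2.7; Bruè–De Lellis 2023, §3.1), so the approximations, the a priori bounds and the
compact limit all live in `H_sym`, and an `L²` class invariant under every `τ_s` has a pointwise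
`x₃`-independent representative. (Equivalently: 2-D global unique Leray–Hopf solvability plus
linear advection–diffusion for `u₃`, glued by Prop. 2.7.) Vendored as a named fact at the request
of route `AnomalousDissipation/TwoAndHalfD` (crux `symmetric_lh_existence`); the steady smooth
specialisation with that crux's exact signature is the proved corollary
`hopf_existence_torus_invariant.symmetric_lh_existence`. **Tagging:** no print states Leray–Hopf
existence *with* the invariance clause; this is a folklore strengthening of Hopf 1951 (same
Galerkin proof in the invariant subspace), the `(2+½)`-dimensional structure being that of
Bruè–De Lellis 2023, §3.1. [folklore] [cite: Hopf1951, Math. Nachr. 4, §§2–4] [cite: BrueDeLellis2023, §3.1] -/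
def hopf_existence_torus_invariant : Prop :=
  ∀ (ν : ℝ) (hν : 0 < ν) (u₀ : 𝕋³ → ℝ³) (hu₀ : MemLp u₀ 2 volume) (hdiv : FunctionSpaces.Torus.IsWeaklyDivFree u₀)
    (hu₀inv : ∀ (s : UnitAddCircle) (x : 𝕋³), u₀ (x + Pi.single (2 : Fin 3) s) = u₀ x)
    (f : ℝ → 𝕋³ → ℝ³)
    (hf : AEStronglyMeasurable (FunctionSpaces.Torus.stLift f) (volume.restrict (Ioi 0 ×ˢ univ)))
    (hf₂ : ∀ T, 0 < T → ∫⁻ t in Ioo 0 T, ∫⁻ x, ‖f t x‖ₑ ^ 2 < ∞)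
    (hfinv : ∀ (t : ℝ) (s : UnitAddCircle) (x : 𝕋³), f t (x + Pi.single (2 : Fin 3) s) = f t x),
    ∃ u : ℝ → 𝕋³ → ℝ³, Torus.IsGlobalLerayHopf ν f u₀ u ∧
      ∀ (t : ℝ) (s : UnitAddCircle) (x : 𝕋³), u t (x + Pi.single (2 : Fin 3) s) = u t x

/-- Forgetting the invariance clause: within the invariant class, `hopf_existence_torus_invariant`
gives in particular a global Leray–Hopf solution (projection). [folklore] -/
theorem hopf_existence_torus_invariant.exists_isGlobalLerayHopf
    (h : hopf_existence_torus_invariant) {ν : ℝ} (hν : 0 < ν) {u₀ : 𝕋³ → ℝ³}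
    (hu₀ : MemLp u₀ 2 volume) (hdiv : FunctionSpaces.Torus.IsWeaklyDivFree u₀)
    (hu₀inv : ∀ (s : UnitAddCircle) (x : 𝕋³), u₀ (x + Pi.single (2 : Fin 3) s) = u₀ x)
    {f : ℝ → 𝕋³ → ℝ³}
    (hf : AEStronglyMeasurable (FunctionSpaces.Torus.stLift f) (volume.restrict (Ioi 0 ×ˢ univ)))
    (hf₂ : ∀ T, 0 < T → ∫⁻ t in Ioo 0 T, ∫⁻ x, ‖f t x‖ₑ ^ 2 < ∞)
    (hfinv : ∀ (t : ℝ) (s : UnitAddCircle) (x : 𝕋³), f t (x + Pi.single (2 : Fin 3) s) = f t x) :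
    ∃ u : ℝ → 𝕋³ → ℝ³, Torus.IsGlobalLerayHopf ν f u₀ u := by
  obtain ⟨u, hu, -⟩ := h ν hν u₀ hu₀ hdiv hu₀inv f hf hf₂ hfinv
  exact ⟨u, hu⟩

/-- **The 2½-D crux of route `AnomalousDissipation/TwoAndHalfD`** (`symmetric_lh_existence`,
verbatim signature): for `ν > 0`, a smooth divergence-free steady force `f` and an `L²` weakly
divergence-free datum `u₀`, both invariant under the translations `x ↦ x + s e₃`, there is a
global Leray–Hopf solution of the system forced by `(t ↦ f)` all of whose slices are invariant
under the same translations. Real proof: `hopf_existence_torus_invariant` with the steady force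
`fun _ => f`, whose measurability and strip-wise square-integrability are
`aestronglyMeasurable_stLift_const` / `lintegral_enorm_sq_const_lt_top`; the hypothesis
`Torus.IsDivFree f` is not needed (the Leray–Hopf formulation is pressure-free) and is kept only
to match the crux. [folklore] -/
theorem hopf_existence_torus_invariant.symmetric_lh_existence
    (h : hopf_existence_torus_invariant) :
    ∀ (ν : ℝ) (f u₀ : 𝕋³ → ℝ³), 0 < ν → FunctionSpaces.Torus.IsSmooth f → FunctionSpaces.Torus.IsDivFree f →
      (∀ (s : UnitAddCircle) (x : 𝕋³), f (x + Pi.single (2 : Fin 3) s) = f x) →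
      MemLp u₀ 2 volume → FunctionSpaces.Torus.IsWeaklyDivFree u₀ →
      (∀ (s : UnitAddCircle) (x : 𝕋³), u₀ (x + Pi.single (2 : Fin 3) s) = u₀ x) →
      ∃ u : ℝ → 𝕋³ → ℝ³, Torus.IsGlobalLerayHopf ν (fun _ => f) u₀ u ∧
        ∀ (t : ℝ) (s : UnitAddCircle) (x : 𝕋³), u t (x + Pi.single (2 : Fin 3) s) = u t x :=
  fun ν f u₀ hν hf _ hfinv hu₀ hdiv hu₀inv =>
    h ν hν u₀ hu₀ hdiv hu₀inv (fun _ => f) (aestronglyMeasurable_stLift_const hf _)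
      (fun T _ => lintegral_enorm_sq_const_lt_top hf T) fun _ => hfinv

end SteadyInvariant

/-! #### ns.S07: Ladyzhenskaya–Prodi–Serrin -/

/-- **ns.S07** (Ladyzhenskaya–Prodi–Serrin conditional regularity; Prodi 1959; Serrin 1962,
ARMA 9, and 1963, §§3–4; Ladyzhenskaya 1967; modern form Robinson–Rodrigo–Sadowski 2016,
Thm. 8.17; Escauriaza–Seregin–Šverák 2003, Thm. 1.4 for the shape of the conclusion).
Let `ν > 0` and let `u` be a Leray–Hopf weak solution of the unforced system on `ℝ³ × [0, T)`
with `u ∈ L^q(0, T; L^r(ℝ³))`, `2/q + 3/r ≤ 1`, `3 < r ≤ ∞`. Then `u` is smooth on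
`(0, T] × ℝ³` (up to and including the final time): there is a classical solution `(v, p)` on
the time set `Ioc 0 T` with `u(t) = v(t)` a.e. for every `t ∈ (0, T]`. (Uniqueness:
`weak_strong_uniqueness`.) The integrability hypothesis is on the open interval `(0, T)`
(a.e.-equivalent). The exponents live in `ℝ≥0∞`, so `r = ∞` (`3/∞ = 0`) is included; the
spatial exponent is called `r` (not the customary `p`) because `p` denotes the pressure. [cite: Prodi1959] -/
def ladyzhenskaya_prodi_serrin : Prop :=
  ∀ {ν T : ℝ} (hν : 0 < ν) (hT : 0 < T) {u₀ : ℝ³ → ℝ³} {u : ℝ → ℝ³ → ℝ³} (hu : FluidPDE.IsLerayHopfOn T ν 0 u₀ u) {q r : ℝ≥0∞} (hr : 3 < r) (hqr : 2 / q + 3 / r ≤ 1) (hS : FluidPDE.MemLqLp q r u (Ioo 0 T)),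
    ∃ (v : ℝ → ℝ³ → ℝ³) (p : ℝ → ℝ³ → ℝ),
      FluidPDE.IsClassicalNSSolutionOn (Ioc 0 T) ν 0 v p ∧ ∀ t ∈ Ioc 0 T, u t =ᵐ[volume] v t

/-- **ns.S07** (weak–strong uniqueness in the Ladyzhenskaya–Prodi–Serrin class; Prodi 1959;
Serrin 1963, Thm. 6; Robinson–Rodrigo–Sadowski 2016, Thm. 8.19).
Let `ν > 0` and let `u` be a Leray–Hopf weak solution of the unforced system on `ℝ³ × [0, T)`
with `u ∈ L^q(0, T; L^r)`, `2/q + 3/r ≤ 1`, `3 < r ≤ ∞`. Then every Leray–Hopf weak solution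
`v` on `[0, T)` with the same viscosity and datum coincides with `u` up to and including the
final time: `v(t) = u(t)` a.e. for every `t ∈ (0, T]` (both `u T` and `v T` are the weak-`L²`
limits of the earlier slices, by the weak-continuity clause of `Fluid.IsLerayHopfOn`; `t = 0`
is excluded since the slices `u 0`, `v 0` are not constrained). [cite: Prodi1959] -/
def weak_strong_uniqueness : Prop :=
  ∀ {ν T : ℝ} (hν : 0 < ν) (hT : 0 < T) {u₀ : ℝ³ → ℝ³} {u v : ℝ → ℝ³ → ℝ³} (hu : FluidPDE.IsLerayHopfOn T ν 0 u₀ u) {q r : ℝ≥0∞} (hr : 3 < r) (hqr : 2 / q + 3 / r ≤ 1) (hS : FluidPDE.MemLqLp q r u (Ioo 0 T)) (hv : FluidPDE.IsLerayHopfOn T ν 0 u₀ v),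
    ∀ t ∈ Ioc 0 T, v t =ᵐ[volume] u t

/-! #### ns.S08: the endpoint `L^∞_t L³_x` -/

/-- **ns.S08** (Escauriaza–Seregin–Šverák endpoint regularity; Escauriaza–Seregin–Šverák 2003,
Russ. Math. Surveys 58, Thms. 1.3–1.4).
Let `ν > 0` and let `u` be a Leray–Hopf weak solution of the unforced Cauchy problem on
`ℝ³ × [0, T)` with `u ∈ L^∞(0, T; L³(ℝ³))`. Then `u` is smooth on `Q_T = (0, T) × ℝ³` (there is
a classical solution `(v, p)` on `(0, T)` with `u(t) = v(t)` a.e. for every `t ∈ (0, T)`; the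
open strip exactly as ESS Thm. 1.4) and unique among Leray–Hopf solutions on `[0, T)` with the
same datum (slices compared on `(0, T]`, as in `weak_strong_uniqueness`); modern statement
Robinson–Rodrigo–Sadowski 2016, Thm. 16.4 ("`u ∈ L^∞(0,T;L³(ℝ³))` ⇒ smooth (and hence unique)"). [cite: EscauriazaSereginSverak2003, Thms. 1.3–1.4] [cite: RobinsonRodrigoSadowski2016, Thm. 16.4] -/
def ess_endpoint : Prop :=
  ∀ {ν T : ℝ} (hν : 0 < ν) (hT : 0 < T) {u₀ : ℝ³ → ℝ³} {u : ℝ → ℝ³ → ℝ³} (hu : FluidPDE.IsLerayHopfOn T ν 0 u₀ u) (h₃ : FluidPDE.MemLqLp ∞ 3 u (Ioo 0 T)),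
    (∃ (v : ℝ → ℝ³ → ℝ³) (p : ℝ → ℝ³ → ℝ),
      FluidPDE.IsClassicalNSSolutionOn (Ioo 0 T) ν 0 v p ∧ ∀ t ∈ Ioo 0 T, u t =ᵐ[volume] v t) ∧
    ∀ v : ℝ → ℝ³ → ℝ³, FluidPDE.IsLerayHopfOn T ν 0 u₀ v → ∀ t ∈ Ioc 0 T, v t =ᵐ[volume] u t

/-- **ns.S08** (Seregin's `L³` blow-up criterion; Seregin 2012, Comm. Math. Phys. 312, Thm. 1.1;
sharpening Escauriaza–Seregin–Šverák 2003, where only `limsup = ∞` was obtained).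
Let `ν > 0` and let `(u, p)` be a maximal smooth solution of the unforced system on
`ℝ³ × [0, T)`, `0 < T < ∞` (classical on `[0, T)`, no smooth continuation past `T`), which is a
Leray–Hopf (finite-energy) solution on `[0, T)` from its datum `u(0) ∈ L² ∩ L³` and is
essentially bounded on every closed sub-strip `[0, T'] × ℝ³`, `0 < T' < T` (regular in Leray's
sense). Then `‖u(t)‖_{L³} → ∞` as `t → T⁻` (a genuine limit, in `ℝ≥0∞`). The Leray–Hopf
hypothesis also normalises the single slice `u T` (weak-`L²` limit of `u(t)`, `t → T⁻`), which
the conclusion does not see. The hypothesis `h₃ : u(0) ∈ L³` is implied by the others (`u 0` is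
continuous, in `L²`, and bounded); it is kept only to mirror Seregin's `u₀ ∈ L² ∩ L³`. [cite: Seregin2012, Comm. Math. Phys. 312  Thm. 1.1] -/
def seregin_L3_blowup : Prop :=
  ∀ {ν T : ℝ} (hν : 0 < ν) (hT : 0 < T) {u : ℝ → ℝ³ → ℝ³} {p : ℝ → ℝ³ → ℝ} (hmax : FluidPDE.IsMaximalSmoothSolution ν 0 u p T) (hlh : FluidPDE.IsLerayHopfOn T ν 0 (u 0) u) (h₃ : MemLp (u 0) 3 volume) (hbdd : ∀ T' ∈ Ioo 0 T, eLpNorm (uncurry u) ∞ (volume.restrict (Icc 0 T' ×ˢ univ)) < ∞),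
    Tendsto (fun t => eLpNorm (u t) 3 volume) (𝓝[<] T) (𝓝 ∞)

/-! #### ns.S19: Leray–Hopf non-uniqueness (open) -/

/-- **ns.S19** (Leray–Hopf non-uniqueness for the unforced Cauchy problem — **open**;
Jia–Šverák 2015, J. Funct. Anal. 268 (conditional scenario via unstable self-similar
solutions); Buckmaster–Vicol 2019, EMS Surv. Math. Sci. 6, §8, Problem 9; Leray 1934, §33 already
asks the question). There are `ν > 0` and a weakly divergence-free datum `u₀ ∈ L²(ℝ³)` admitting
two global Leray–Hopf weak solutions `u`, `v` of the unforced system which are distinct: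
`u(t) ≠ v(t)` on a set of positive measure for some `t > 0`. The time `t = 0` is excluded
because the slice `u 0` of the function `u` is not constrained by `Fluid.IsLerayHopfOn` (the datum
enters only through `u₀`), whereas every positive slice is pinned by weak `L²` continuity.
Stated as a `Prop` (open problem). **Status note (2026-08, statement unchanged).** Open in the cited sources;
Hou–Wang–Yang 2025 (arXiv:2509.25116, Thm. 1; computer-assisted, unrefereed claim) announce infinitely many
distinct suitable Leray–Hopf solutions of the unforced system (`ν = 1`) on `ℝ³ × [0, 1]` from one compactly
supported datum `u₀ ∈ L²`, which yields this statement granted the standard continuation of Leray–Hopf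
solutions to global ones — the content of that theorem is the claim-tagged predicate
`HouWangYang2025.IsNonuniqueFamily u₀ U` of `HouWangYang2025Nonuniqueness.lean` (no named fact is minted for an
unrefereed claim), with the proved reduction `HouWangYang2025.IsNonuniqueFamily.lerayHopfNonUniqueness` (and,
generally, `LerayHopfNonUniqueness.of_isLerayHopfOn`: local-in-time non-uniqueness plus continuation). This
statement implies its energy-class variant: `LerayHopfNonUniqueness.energyClassNonUniqueness`
(`NSLerayHopfNonUniqueness.lean`). [cite: BuckmasterVicol2019, EMS Surv. Math. Sci. 6  §8  Problem 9] -/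
@[conjecture] def LerayHopfNonUniqueness : Prop :=
  ∃ ν : ℝ, 0 < ν ∧ ∃ u₀ : ℝ³ → ℝ³, MemLp u₀ 2 volume ∧ FluidPDE.IsWeaklyDivFree u₀ ∧
    ∃ u v : ℝ → ℝ³ → ℝ³, FluidPDE.IsGlobalLerayHopf ν 0 u₀ u ∧ FluidPDE.IsGlobalLerayHopf ν 0 u₀ v ∧
      ∃ t, 0 < t ∧ ¬ (u t =ᵐ[volume] v t)

/-- The **energy class** `L^∞(0, T; L²(ℝ³)) ∩ L²(0, T; Ḣ¹(ℝ³))` for a time-dependent field on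
`[0, T)`: `∫ ‖u(t)‖² ≤ C` for a.e. `t ∈ (0, T)`, and `u(t)` has a weak gradient `G(t)` for a.e.
`t` with `∫₀ᵀ ∫ |G|² < ∞` — the first two Leray–Hopf clauses (`energy_bound`, the integrability
half of `weakGrad_energy`) **without** any energy inequality (Buckmaster–Vicol 2019, Ann. of
Math. 189, §1.1: "weak solutions of finite energy … in `L^∞_t L²_x ∩ L²_t Ḣ¹_x`"; EMS Surv. 2019,
§8). Stated, like `Fluid.IsLerayHopfOn`, over a general finite-dimensional real inner product
space `E`. Auxiliary for `EnergyClassNonUniqueness`. [cite: BuckmasterVicol2019, Ann. of Math. 189  §1.1: "weak solutions] -/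
def MemEnergyClass {E : Type*} [NormedAddCommGroup E] [InnerProductSpace ℝ E]
    [FiniteDimensional ℝ E] [MeasurableSpace E] [BorelSpace E] (T : ℝ) (u : ℝ → E → E) :
    Prop :=
  (∃ C : ℝ≥0, ∀ᵐ t ∂(volume.restrict (Ioo 0 T)), FluidPDE.eEnergy (u t) ≤ C) ∧
    ∃ G : ℝ → E → E →L[ℝ] E,
      (∀ᵐ t ∂(volume.restrict (Ioo 0 T)), FluidPDE.HasWeakGradient (u t) (G t)) ∧
      ∫⁻ t in Ioo 0 T, ∫⁻ x, ENNReal.ofReal (FluidPDE.frobeniusNormSq (G t x)) < ∞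

/-- The energy class consists exactly of the `energy_bound` clause and the integrability half of
the `weakGrad_energy` clause of a Leray–Hopf solution: every Leray–Hopf weak solution on `[0, T)`
lies in `L^∞(0, T; L²) ∩ L²(0, T; Ḣ¹)` (Leray 1934, §III; real proof by projection). [cite: Leray1934, §III] -/
theorem memEnergyClass_of_isLerayHopfOn {E : Type*} [NormedAddCommGroup E]
    [InnerProductSpace ℝ E] [FiniteDimensional ℝ E] [MeasurableSpace E] [BorelSpace E]
    {T ν : ℝ} {f u : ℝ → E → E} {u₀ : E → E} (hu : FluidPDE.IsLerayHopfOn T ν f u₀ u) :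
    MemEnergyClass T u := by
  obtain ⟨G, hG, hint, -, -⟩ := hu.weakGrad_energy
  exact ⟨hu.energy_bound, G, hG, hint⟩

/-- **ns.S19** (energy-class variant `W_E` of the non-uniqueness problem — **open**;
Buckmaster–Vicol 2019, Ann. of Math. 189, §1.1 (non-uniqueness is proved there in `C⁰_t L²_x`
but *not* in `L²_t Ḣ¹_x`) and EMS Surv. Math. Sci. 6 (2019), §8; summit
`ns-w-energy-class-nonuniqueness`). There are `ν > 0` and a weakly divergence-free datum
`u₀ ∈ L²(ℝ³)` admitting two distinct global weak solutions of the unforced system in the energy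
class `L^∞_t L²_x ∩ L²_t Ḣ¹_x` (accepted `Fluid.IsWeakNSSolutionOn` on every `[0, T)` plus
`MemEnergyClass`; no energy inequality is imposed). Distinctness is a.e. in space–time. *Status note
(2026-08, statement unchanged):* `LerayHopfNonUniqueness` implies this statement — Leray–Hopf solutions lie
in the energy class (`memEnergyClass_of_isLerayHopfOn`) and two of them that differ at a positive time are,
by weak `L²` continuity, not a.e. equal in space–time; proved as
`energyClassNonUniqueness_of_lerayHopfNonUniqueness` in `NSLerayHopfNonUniqueness.lean`. The bearing of the
Hou–Wang–Yang 2025 claim on `W_E` is recorded in `HouWangYang2025Nonuniqueness.lean`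
(`HouWangYang2025.IsNonuniqueFamily.energyClassNonUniqueness`). [cite: BuckmasterVicol2019, Ann. of Math. 189  §1.1 (non-uniqueness] -/
@[conjecture] def EnergyClassNonUniqueness : Prop :=
  ∃ ν : ℝ, 0 < ν ∧ ∃ u₀ : ℝ³ → ℝ³, MemLp u₀ 2 volume ∧ FluidPDE.IsWeaklyDivFree u₀ ∧
    ∃ u v : ℝ → ℝ³ → ℝ³,
      (∀ T, 0 < T → FluidPDE.IsWeakNSSolutionOn T ν 0 u₀ u ∧ MemEnergyClass T u) ∧
      (∀ T, 0 < T → FluidPDE.IsWeakNSSolutionOn T ν 0 u₀ v ∧ MemEnergyClass T v) ∧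
      ¬ (uncurry u =ᵐ[volume.restrict (Ioi 0 ×ˢ univ)] uncurry v)

/-! #### ns.S20: Albritton–Brué–Colombo -/

/-- **ns.S20** (non-uniqueness of Leray solutions of the *forced* Navier–Stokes equations;
Albritton–Brué–Colombo 2022, Ann. of Math. 196, Thm. 1.1). For every `ν > 0` (the theorem is
stated for `ν = 1`; the general case follows by the Navier–Stokes scaling) there are `T > 0` and
a body force `f ∈ L¹(0, T; L²(ℝ³))` such that the forced system on `ℝ³ × (0, T)` with **zero**
initial datum admits two Leray–Hopf weak solutions `u`, `v` which are distinct (`u(t) ≠ v(t)` on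
a set of positive measure for some `t ∈ (0, T)`). [cite: AlbrittonBrueColombo2022, Ann. of Math. 196  Thm. 1.1] -/
def albritton_brue_colombo : Prop :=
  ∀ (ν : ℝ) (hν : 0 < ν),
    ∃ T : ℝ, 0 < T ∧ ∃ f : ℝ → ℝ³ → ℝ³, FluidPDE.MemLqLp 1 2 f (Ioo 0 T) ∧
      ∃ u v : ℝ → ℝ³ → ℝ³, FluidPDE.IsLerayHopfOn T ν f 0 u ∧ FluidPDE.IsLerayHopfOn T ν f 0 v ∧
        ∃ t ∈ Ioo 0 T, ¬ (u t =ᵐ[volume] v t)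

/-! #### ns.S28: Leray's necessary conditions at a blow-up time; Scheffer -/

/-- **ns.S28** (Leray's lower bounds on the `L^r` norms before a blow-up time, `3 < r < ∞`;
Leray 1934, Acta Math. 63, §22, p. 227, "Caractère des irrégularités: Si une solution devient
irrégulière à l'époque `T`, on a
`{∭ [uᵢuᵢ]^{p/2} δx}^{1/p} > A(1 - 3/p) ν^{(1+3/p)/2} (T - t)^{-(1-3/p)/2}` (`p > 3`)", stated
there without proof ("on établit de même", by the method of §21); proved in Giga 1986,
J. Differential Equations 62, Thm. 4, (4.8) ("In the case `Ω = ℝ³`, (4.8) was given by Leray"),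
and in Ożański–Pooley 2018, Cor. 6.25 (via Lemma 6.23 (iii), Cor. 6.24 (iii));
Robinson–Rodrigo–Sadowski 2016, Notes to Ch. 11, (11.18) and Exercises 11.6–11.8). For every
`3 < r < ∞` there is a constant `c_r > 0` such that: if `ν > 0` and `(u, p)` is a maximal smooth
solution of the unforced system on `ℝ³ × [0, T)`, `0 < T < ∞`, which is a Leray–Hopf
(finite-energy) solution from its datum `u(0)` and is essentially bounded on every closed
sub-strip `[0, T'] × ℝ³`, `0 < T' < T`
(a "solution régulière", §15, becoming irregular at `T`, §19 p. 224), then for every `t ∈ [0, T)`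
`‖u(t)‖_{L^r} ≥ c_r ν^{(r+3)/(2r)} (T - t)^{-(r-3)/(2r)}`.
Norms in `ℝ≥0∞` (`‖u(t)‖_r = ∞` is allowed and satisfies the bound trivially). The Leray–Hopf
hypothesis also normalises the single slice `u T` (weak-`L²` limit of the earlier slices), which
the conclusion (on `Ico 0 T`) does not see; here `u 0` *is* the datum (classical on `Ico 0 T`).
The exponent is called `r` because `p` denotes the pressure. Leray's constant `A(1 - 3/p)` is
weakened to an unspecified `c_r > 0`. *Decomposition (2026-08, statement unchanged):* proved glue
`leray_blowup_rate_of_top_of_supnorm : leray_blowup_rate_top → leray_supnorm_le_of_Lp →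
leray_blowup_rate` (`NSLerayBlowupRateLp.lean`, Ożański–Pooley's proof of Cor. 6.25). Not yet
discharged: `leray_blowup_rate_holds` will be that glue applied to the discharges of the two
leaves (`leray_strong_local_existence`, `leray_supnorm_le_of_Lp`), neither of which has landed,
and is to live downstream of the assembly file — no further decomposition is called for.
[cite: Leray1934, §22 p. 227] [cite: OzanskiPooley2018, Cor. 6.25]
[cite: Giga1986, Thm. 4 (4.8) p. 202] -/
def leray_blowup_rate : Prop :=
  ∀ (r : ℝ) (hr : 3 < r),
    ∃ c : ℝ, 0 < c ∧ ∀ (ν T : ℝ), 0 < ν → 0 < T → ∀ (u : ℝ → ℝ³ → ℝ³) (p : ℝ → ℝ³ → ℝ),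
      FluidPDE.IsMaximalSmoothSolution ν 0 u p T → FluidPDE.IsLerayHopfOn T ν 0 (u 0) u →
      (∀ T' ∈ Ioo 0 T, eLpNorm (uncurry u) ∞ (volume.restrict (Icc 0 T' ×ˢ univ)) < ∞) →
      ∀ t ∈ Ico 0 T,
        ENNReal.ofReal (c * ν ^ ((r + 3) / (2 * r)) * (T - t) ^ (-((r - 3) / (2 * r)))) ≤
          eLpNorm (u t) (ENNReal.ofReal r) volume

/-- **ns.S28** (Leray's lower bound on the maximum velocity before a blow-up time, the case
`r = ∞`; Leray 1934, Acta Math. 63, §19, (3.8)–(3.9), p. 224, "Un premier caractère des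
irrégularités: Si une solution des équations de Navier devient irrégulière à l'époque `T`, alors …
`V(t) > A √(ν/(T - t))`", `V(t) = max |u(x, t)|`, a consequence of the local existence theorem of
§19 with the lifespan (3.8) `τ = A ν V⁻²`; Ożański–Pooley 2018, Cor. 6.25 with Thm. 6.22). There is
a universal `c > 0` such that, for `(u, p)` as in `leray_blowup_rate` (including the same harmless
normalisation of the slice `u T` by the Leray–Hopf hypothesis), `‖u(t)‖_{L^∞} ≥ c √ν (T - t)^{-1/2}`
for every `t ∈ [0, T)`. *Decomposition (2026-08, statement unchanged):* proved glue
`leray_blowup_rate_top_of_strong_local_existence : leray_strong_local_existence →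
leray_blowup_rate_top` (`NSLerayBlowupRate.lean`: local existence from the slice `u(t₀)`, the proved
weak–strong uniqueness `serrin_weak_strong_uniqueness_holds`, gluing past `T`). Not yet discharged:
`leray_blowup_rate_top_holds` will be that glue applied to the discharge of
`leray_strong_local_existence` (not yet landed), downstream of the assembly file.
[cite: Leray1934, §19 (3.8)–(3.9) p. 224] [cite: OzanskiPooley2018, Cor. 6.25 with Thm. 6.22] -/
def leray_blowup_rate_top : Prop :=
  ∃ c : ℝ, 0 < c ∧ ∀ (ν T : ℝ), 0 < ν → 0 < T → ∀ (u : ℝ → ℝ³ → ℝ³) (p : ℝ → ℝ³ → ℝ),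
      FluidPDE.IsMaximalSmoothSolution ν 0 u p T → FluidPDE.IsLerayHopfOn T ν 0 (u 0) u →
      (∀ T' ∈ Ioo 0 T, eLpNorm (uncurry u) ∞ (volume.restrict (Icc 0 T' ×ˢ univ)) < ∞) →
      ∀ t ∈ Ico 0 T,
        ENNReal.ofReal (c * Real.sqrt ν / Real.sqrt (T - t)) ≤ eLpNorm (u t) ∞ volume

/-- **ns.S28** (the singular times of a Leray–Hopf solution form an `ℋ^{1/2}`-null set;
Leray 1934, Acta Math. 63, §34 (structure theorem: regularity outside a closed set of times of
measure zero, with `∑ √|Iₖ|`-control); Scheffer 1977, Comm. Math. Phys. 55 (Hausdorff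
`½`-measure zero); Robinson–Rodrigo–Sadowski 2016, Thm. 8.14 and Cor. 8.16).
Let `ν > 0` and let `u` be a Leray–Hopf weak solution of the unforced system on `ℝ³ × [0, T₀)`.
Then the set of times `T ∈ (0, T₀)` which are singular for `u` (some `(T, x)` is not a regular
point: `u` is essentially unbounded on every parabolic cylinder about it; accepted
`Fluid.IsSingularTime`) has one-half-dimensional Hausdorff measure zero. [cite: Leray1934, Acta Math. 63  §34 (structure theorem: r] -/
def scheffer_singular_times : Prop :=
  ∀ {ν T₀ : ℝ} (hν : 0 < ν) (hT₀ : 0 < T₀) {u₀ : ℝ³ → ℝ³} {u : ℝ → ℝ³ → ℝ³} (hu : FluidPDE.IsLerayHopfOn T₀ ν 0 u₀ u),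
    μH[(1 / 2 : ℝ)] {T ∈ Ioo 0 T₀ | FluidPDE.IsSingularTime u T} = 0

/-! #### Energy equality for distributional solutions in `L⁴_t L⁴_x` (Lions 1960; Galdi 2018) -/

/-- **Galdi's energy equality for very weak solutions** (Galdi 2018, Proc. AMS 147, Thm. 1.1;
removing the Leray–Hopf hypothesis from J.-L. Lions' 1960 `L⁴_t L⁴_x` criterion). Let `T > 0`,
`u₀ ∈ L²_σ(ℝ³)` (square integrable and weakly divergence free), and let `u ∈ L²_loc` be a
distributional (pressure-free, divergence-free-tested) solution of the unforced Navier–Stokes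
system on `ℝ³ × (0, T)` with datum `u₀` — Galdi's (1.5), which is the accepted
`Fluid.IsWeakNSSolutionOn T ν 0 u₀ u` (tests supported in `t < T`, datum term at `t = 0`, weak
divergence-freeness slice-wise a.e.). If moreover `u ∈ L⁴(0, T; L⁴(ℝ³))`, then `u` lies in the
Leray–Hopf class `L^∞(0, T; L²) ∩ L²(0, T; H¹)` "and thus obeys the energy equality"
`½‖u(t)‖₂² + ν ∫₀ᵗ ‖∇u‖₂² = ½‖u₀‖₂²`. NO a-priori finite energy or finite dissipation is assumed.
Rendering: the gradient is a weak gradient `G t` of the slice `u t` for a.e. `t` (as in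
`Fluid.IsLerayHopfOn`); since `u` is an honest function seen only through integrals, the energy
identity is asserted for a.e. `t ∈ (0, T)` (Galdi: for every `t ∈ [0, T]` along the
`L²`-continuous representative — the a.e. form is implied and representative-independent).
Galdi normalises `ν = 1` (footnote 1, "without loss of generality"): `v(x, t) := ν⁻¹ u(x, t/ν)`
solves the `ν = 1` system on `(0, νT)` iff `u` solves the `ν` system on `(0, T)`, and all
hypothesis/conclusion classes are invariant under this map — stated here for all `ν > 0`.
[cite: Galdi2018, Thm 1.1] -/
def galdi_energy_equality : Prop :=
  ∀ {ν T : ℝ} (hν : 0 < ν) (hT : 0 < T) {u₀ : ℝ³ → ℝ³} {u : ℝ → ℝ³ → ℝ³} (hu₀ : MemLp u₀ 2 volume) (hdiv₀ : FluidPDE.IsWeaklyDivFree u₀) (hw : FluidPDE.IsWeakNSSolutionOn T ν 0 u₀ u) (h₄ : FluidPDE.MemLqLp 4 4 u (Ioo 0 T)),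
    FluidPDE.MemLqLp ∞ 2 u (Ioo 0 T) ∧
    ∃ G : ℝ → ℝ³ → ℝ³ →L[ℝ] ℝ³,
      (∀ᵐ t ∂(volume.restrict (Ioo 0 T)), FluidPDE.HasWeakGradient (u t) (G t)) ∧
      (∫⁻ t in Ioo 0 T, ∫⁻ x, ENNReal.ofReal (FluidPDE.frobeniusNormSq (G t x)) < ∞) ∧
      ∀ᵐ t ∂(volume.restrict (Ioo 0 T)), VectorCalculus.kineticEnergy (u t) +
        ν * (∫⁻ τ in Ioo 0 t, ∫⁻ x, ENNReal.ofReal (FluidPDE.frobeniusNormSq (G τ x))).toReal =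
          VectorCalculus.kineticEnergy u₀

end Literature.Analysis.FluidPDE
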